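import Summits.ABC.IUTFork.Joshi.TestIndeterminacies
import Summits.ABC.IUTFork.Joshi.DictionaryCollation
import Summits.ABC.IUTFork.Joshi.TestIsmScalingShells
import HarnessLib

/-!
# Block-E TEST file: the (+) horn for the T-18 / D-10 dictionary hypotheses AT THE X-07′ CARRIERS `scalShells`
# («Joshi-style (Ind2)»: Ism := ALL linear automorphisms of the container line; E-t41's `Joshi/TestIsmScalingShells.lean`)

Test file of the abc-iut cell, branch E (rung LADDER-ABC:A2.E; seat abc-iut-E-t18, cx hand on X-07′ consequences per ASSIGNMENTS v2). **No
side is taken** on [IUTchIII] Cor. 3.12, on Joshi's claims, or on Mochizuki's report on them; typed ≠ proved ≠ endorsed; a model EXHIBITS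
satisfiability of typed hypotheses, nothing more. NO abc claim.

WHAT IS HERE (everything imported BY NAME). At E-t41's `IsmScaling.scalShells` — abc-iut-w4-d101's pinned ℚ-line carriers with the ONE field
`ism` changed to `Set.univ` («Q_p-linear isomorphisms σ», [J-III] §8.11.1 p.91 l.44–46, read literally) — the located Props of T-18 and D-10 hold for
EVERY dictionary, CONTENTFULLY: `jInd2InIsm_scalShells`, `collationInIsm_scalShells` (instances of T-18's `jInd2InIsm_of_ism_univ` by `rfl`), hence
`MovesAreInd`/Y1 need only the seed's own components there (`ansatzWithinInd_scalShells`). And the SAME dictionary shape that the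
pinned countermodel REFUTES — one σ acting on a container line by a genuine rescaling `x ↦ p^a·x`, `a ≠ 0` (`not_jInd2InIsm_of_rescaling`, Ism =
{±1} there) — SATISFIES `JInd2InIsm` here (`rescalingDictionary`, `jInd2InIsm_rescalingDictionary` vs `not_jInd2InIsm_rescalingDictionary_signShells`):
the two horns of T-18's location exhibited on one dictionary shape over the two carriers (which differ in `ism` only). What this (Ind2) does to the
typed Θ-hull / Statement is X-07′ parts I–II (E-t41) and E-t43's volume-character dichotomy — not this file. [claim: Joshi2024ATS3, status: disputed];
our side [claim: Mochizuki2012, status: disputed]. Standard axioms only.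
-/

noncomputable section

namespace Summit.ABC.IUTFork.Joshi.ATS3.IndDictionary

open Function Set Thm311 Cor312 Cor312.Checks Cor312.IdentifiedNonVacuity Cor312Vol Joshi Joshi.IsmScaling

variable {𝔍 : RosettaIndDatum}

/-! ## 1. Every dictionary satisfies the Ism-type hypotheses at `scalShells` -/

/-- **At the X-07′ carriers every T-18 dictionary satisfies `JInd2InIsm`** (Ism = all linear automorphisms of the line: `rfl`-instance of
`jInd2InIsm_of_ism_univ`). The (+) horn for T-18, contentful: whatever Joshi's σ do to the containers. [claim: Joshi2024ATS3, status: disputed] -/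
theorem jInd2InIsm_scalShells {S : LatticeSituation toyIndex} (hS : S.L = scalShells) (𝔇' : IndDictionary 𝔍 S.L) : 𝔇'.JInd2InIsm :=
  𝔇'.jInd2InIsm_of_ism_univ fun w => by rw [hS]

/-- The same for a dictionary typed directly over `scalShells`. [claim: Joshi2024ATS3, status: disputed] -/
theorem jInd2InIsm_scalShells' (𝔇' : IndDictionary 𝔍 scalShells) : 𝔇'.JInd2InIsm := fun _ _ _ => Set.mem_univ _

/-- **At the X-07′ carriers every D-10 collation dictionary satisfies `CollationInIsm`** (hence `CollationInInd`). [claim: Joshi2024ATS3, status: disputed] -/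
theorem collationInIsm_scalShells {Y : Type*} {W : Type*} {H : Y → W → Type*} {C : ClassCollationDatum Y W H}
    (𝔠 : CollationDictionary C scalShells) : 𝔠.CollationInIsm := fun _ _ _ _ _ _ => Set.mem_univ _

/-- **Y1 at any lattice situation over `scalShells` needs only the seed's own components** (`BaseIsThetaPilot ∧ DatumEquivariant ∧ StdReachable`
+ `FactorsThrough` through a T-18 dictionary with trivialised Ind1 half): the located Props are automatic there. Whether such a situation carries an
honest Cor-3.12 setting with S is X-07′ parts I–II (E-t41). [claim: Joshi2024ATS3, status: disputed] -/
theorem ansatzWithinInd_scalShells {S : LatticeSituation toyIndex} (hS : S.L = scalShells) (𝔇' : IndDictionary 𝔍 S.L)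
    {P : Cor312.Setting S.toSituation}
    (ρ : (∀ v : toyIndex.V, v ∈ toyIndex.Vbad → Set (S.L.StarPacket v)) → ∀ (j : toyIndex.Label) (vQ : toyIndex.VQ), Set (S.L.Packet j vQ))
    (𝔈 : Joshi.Dictionary S) (hB : Joshi.BaseIsThetaPilot 𝔈 (P := P)) (hE : Joshi.DatumEquivariant 𝔈) (hR : Joshi.StdReachable 𝔈)
    (hf : 𝔇'.withTrivialInd1.FactorsThrough 𝔈) : Joshi.AnsatzWithinInd ρ 𝔈 (P := P) :=
  𝔇'.ansatzWithinInd_of_ism_univ (fun w => by rw [hS]) ρ 𝔈 hB hE hR hf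

/-! ## 2. One dictionary shape, two carriers: the rescaling σ -/

variable (p : ℕ) [hp : Fact p.Prime]

/-- **The rescaling dictionary over a ℚ-line signature `L`** (carriers `ℚ` at every place, as `signShells` / `scalShells`): EVERY Ind2 element σ of
the Joshi datum acts on EVERY container line by `x ↦ p^a·x` (Joshi's untilt change DILATES valuations: [J-I] §10; [J-III] (4.2.2.2); E-t41's
`ppowUnit`); Ind1 half trivial; places and column index arbitrary. DATA. [claim: Joshi2024ATS3, status: disputed] -/
def rescalingDictionary (A I : Set (ℚ ≃ₗ[ℚ] ℚ)) (hA : LinearEquiv.refl ℚ ℚ ∈ A) (hI : LinearEquiv.refl ℚ ℚ ∈ I) (a : ℤ)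
    (placeOf : 𝔍.V → toyIndex.V) (colIndex : 𝔍.GlobalPt → ℤ) : IndDictionary 𝔍 (lineShells A I hA hI) :=
  ⟨placeOf, fun _ _ _ => LinearEquiv.smulOfUnit (ppowUnit p a), fun _ _ _ => LinearEquiv.refl ℚ ℚ, colIndex⟩

/-- The rescaling dictionary's σ act by the scalar `p^a`. [folklore] -/
theorem rescalingDictionary_apply (A I : Set (ℚ ≃ₗ[ℚ] ℚ)) (hA : LinearEquiv.refl ℚ ℚ ∈ A) (hI : LinearEquiv.refl ℚ ℚ ∈ I) (a : ℤ)
    (placeOf : 𝔍.V → toyIndex.V) (colIndex : 𝔍.GlobalPt → ℤ) (v : 𝔍.V) (σ : 𝔍.AutG v) (w : toyIndex.V) (y : ℚ) :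
    (rescalingDictionary p A I hA hI a placeOf colIndex).carrierAut v σ w y = (p : ℚ) ^ a * y := rfl

/-- **(+) at `scalShells`**: the rescaling dictionary satisfies `JInd2InIsm` (and `JInd1InStripAut`). [claim: Joshi2024ATS3, status: disputed] -/
theorem jInd2InIsm_rescalingDictionary (a : ℤ) (placeOf : 𝔍.V → toyIndex.V) (colIndex : 𝔍.GlobalPt → ℤ) :
    (rescalingDictionary (𝔍 := 𝔍) p signs Set.univ (Set.mem_insert _ _) (Set.mem_univ _) a placeOf colIndex).JInd2InIsm ∧
      (rescalingDictionary (𝔍 := 𝔍) p signs Set.univ (Set.mem_insert _ _) (Set.mem_univ _) a placeOf colIndex).JInd1InStripAut :=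
  ⟨fun _ _ _ => Set.mem_univ _, fun _ _ _ => Set.mem_insert _ _⟩

/-- **(−) at `signShells`-type carriers** (Ism = {±1}, the pinned countermodel's): the SAME rescaling dictionary with `a ≠ 0` VIOLATES `JInd2InIsm`
as soon as the Joshi datum has one Ind2 element somewhere (T-18's `not_jInd2InIsm_of_rescaling`: `|p^a| ≠ 1`). [claim: Joshi2024ATS3, status: disputed] -/
theorem not_jInd2InIsm_rescalingDictionary_signs (a : ℤ) (ha : a ≠ 0) (placeOf : 𝔍.V → toyIndex.V) (colIndex : 𝔍.GlobalPt → ℤ)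
    (v : 𝔍.V) (σ : 𝔍.AutG v) :
    ¬ (rescalingDictionary (𝔍 := 𝔍) p signs signs (Set.mem_insert _ _) (Set.mem_insert _ _) a placeOf colIndex).JInd2InIsm := by
  intro h2
  obtain ⟨s, hs, hy⟩ := exists_eq_mul_of_mem_signs (h2 v σ ())
  have e : (p : ℚ) ^ a = s := by
    have h := hy 1
    rw [rescalingDictionary_apply] at h
    simpa using h
  have hp1 : (1 : ℚ) < p := by exact_mod_cast hp.out.one_lt
  have habs : |(p : ℚ) ^ a| ≠ 1 := by
    rw [abs_of_pos (zpow_pos (by positivity) a)]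
    intro h1
    rcases lt_trichotomy a 0 with hlt | rfl | hgt
    · exact absurd h1 (ne_of_lt (zpow_lt_one_of_neg₀ hp1 hlt))
    · exact ha rfl
    · exact absurd h1 (ne_of_gt (one_lt_zpow₀ hp1 hgt))
  exact habs (e ▸ hs)

end Summit.ABC.IUTFork.Joshi.ATS3.IndDictionary

end
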